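import Summits.QuantumFields.BalabanUV.Beta.FP.TowerDoorDefectDefs
import Summits.QuantumFields.BalabanUV.Beta.FP.RepAlgebra

/-!
# `BalabanUV.Beta.FP.TowerDoorDefectLoc` — binder row D1, the row's ONE file, the door's `hWΔ₂` ∕ `hX` ingredient (J-NOTE-21 §4–§5):
# **THE WARD-DEFECT KERNEL OF A BOUNDED GAUGE FUNCTION IS BI-LOCALISED AT ITS COARSE WINDOW** — `BiLoc (defKerZ L tabs κ₂ v β) (L•β.1) (L•β.1) (K·‖v‖_∞) (δ/2)` for every table record
# whose mixed table is a local field–multiplier family ((Lmix) `LocStencilFM L tabs.mixFF C δ`) and whose Hessian table is a vertex family ((LH) `VertexFamily tabs.H L C_H (δ/2)`), from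
# PART 62's spelling of the gradient term as direction-wise `wsum`s (lit `biLoc_wsum`: the weights `(v(u+e_κ) − v u)·e^{−δ|u − L•β.1|₁}` decay from the window, the rescaled stencils
# `e^{+δ|u − L•β.1|₁} • M2Z (u,κ) β` are bi-localised at `(u,u)` with a uniform constant)
# (β-function cell `pub-balaban`, BINDER-OWNERS row D1 ∕ (C1) OWNER «beta-an2» gen 77, PART 64; imports PART 62 + the row's `FP/RepAlgebra`)

WHAT ([folklore] `BiLoc` bookkeeping BY NAME; no `def`, no `def … : Prop`, nothing cited, 0 sorry, default heartbeats).
§1 `biLoc_evenHalf` (`½•(K + sgnK (trK K))` inherits a diagonal bi-localisation — the even twin of `WardLocusParitySplit.biLoc_oddHalf`), **`biLoc_M2Z`** ((Lmix) ⟹ `BiLoc (M2Z L tabs (u,κ) β) u u (wM2·C·e^{−δ|u − L•β.1|₁}) δ`),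
`biLoc_rescaled_M2Z` (the stencil rescaled by `e^{+δ|u − L•β.1|₁}` is bi-localised at `(u,u)` with the uniform constant `wM2·C`).
§2 **`gradTerm_eq_wsum`** (PART 62's direction-`κ` site series IS `wsum w′ K′` with `w′ u := (v(u+e_κ) − v u)·e^{−δ|u−L•β.1|₁}`, `K′ u := e^{δ|u−L•β.1|₁} • M2Z (u,κ) β` — `Real.exp_add`, pointwise),
**`biLoc_gradTerm`** (`|v| ≤ V` ⟹ each direction's series is `BiLoc … (L•β.1) (L•β.1) (2V·wM2·C·Zl(δ/2)) (δ/2)` — lit `biLoc_wsum`).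
§3 **`biLoc_defKerZ`**: `|v| ≤ V`, (Lmix) at rate `δ > 0`, (LH) at rate `δ/2` ⟹ `BiLoc (defKerZ L tabs κ₂ v β) (L•β.1) (L•β.1) ((3+1)·(2V·wM2·C·Zl(δ/2)) + 2·|κ₂|·V·C_H) (δ/2)`.
WHAT THIS IS NOT: not `hWΔ₂` itself (the door superposes these kernels with the `wΦ` weights and `v := λℤ_a` — PART 59's extra factor `e^{−δ′|L•β.1 − L•a|}` and PART 63-class summation come next), not `hX`;
nothing of Bałaban's asserted, valued or discharged; 0 estimates (bookkeeping constants); 0∕4 row-D1 binders (hW, hR, D1Tel, D1Rep); NOT (C1), NOT D1, NEVER «G-an2-4 closed», NOT BetaPertH, NOT continuum, NOT Clay.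

HONEST DEPENDENCY (page 1, mandatory): continuum YM on T⁴ ⇐ BetaPertH ∧ nine spine estimates (0/9 proved); BetaPertH ⇐ (D1) ∧ (D4) ∧ CAP+tail;
G-an2-4 gates asym, D1 and NE2/3/4.  HONEST FRAMING (cell contract, verbatim): «discharging `BetaPertH` makes Bałaban's UV stability UNCONDITIONAL —
a real constructive-QFT result; it is NOT the continuum limit and NOT the Clay problem.»  ABSOLUTE RULE (cell charter, verbatim): «No internally-minted
statement may enter as a cited fact. Every hypothesis is either kernel-proved in this package or a verbatim quotation of a PUBLISHED theorem with page
reference. The manuscript(s) under audit are NOT citable for their own disputed steps — they are the thing under adjudication; programme-internal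
(2001/route/tribunal) claims are never citable.»  Row D1 ∕ (C1) OWNER «beta-an2» gen 77, 2026-08-29.  No existing file touched.
-/

noncomputable section

open Finset
open scoped BigOperators
open Literature.MathematicalPhysics.QuantumFieldTheory
open Literature.MathematicalPhysics.QuantumFieldTheory.Balaban1983to89
open Literature.MathematicalPhysics.QuantumFieldTheory.Balaban1983to89.Beta
open Literature.MathematicalPhysics.QuantumFieldTheory.Balaban1983to89.B12Sec2to5 (l1 l1_nonneg)
open AffineAveraging (Site unitVec)
open OneStepResolventKernel (Fib wsum biLoc_wsum)
open ExpKernelCalculus (MKer BiLoc VertexFamily Zl Zl_nonneg)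
open SecondOrderResponse (LocStencilFM biLoc_smul)
open KernelWard (biLoc_add biLoc_sub)
open BalabanStepW2 (M2Of wM2)
open Summit.QuantumFields.BalabanUV.Beta.SymmetrisedStepJets (SymTables)
open Summit.QuantumFields.BalabanUV.Beta.BorderedHessian (sgnF sgnK sgnK_apply)
open Summit.QuantumFields.BalabanUV.Beta.TameKernelCalculus (trK trK_apply)
open Summit.QuantumFields.BalabanUV.Beta.FP.TowerDoorDefectDefs

namespace Summit.QuantumFields.BalabanUV.Beta.FP.TowerDoorDefectLoc

variable {d : ℕ}

/-! ## §1 The symmetrised mixed table is bi-localised at its fine bond -/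

/-- [folklore] **the even half `½•(K + sgnK (trK K))` inherits a diagonal bi-localisation** (the transpose swaps the legs, the signs have modulus one). -/
theorem biLoc_evenHalf {K : MKer (d + 1) (Fib d)} {p : Fin (d + 1) → ℤ} {C δ : ℝ} (h : BiLoc K p p C δ) :
    BiLoc ((1 / 2 : ℝ) • (K + sgnK (trK K))) p p C δ := by
  intro x z a b
  have h1 := h x z a b
  have h2 := h z x b a
  rw [add_comm (l1 (z - p))] at h2
  have hs : |sgnF a * sgnF b| = 1 := by
    have ha : |sgnF (d := d) a| = 1 := by rcases a with κ | κ <;> simp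
    have hb : |sgnF (d := d) b| = 1 := by rcases b with κ | κ <;> simp
    rw [abs_mul, ha, hb, mul_one]
  simp only [Pi.smul_apply, Pi.add_apply, smul_eq_mul, sgnK_apply, trK_apply]
  rw [abs_mul, abs_of_pos (by norm_num : (0 : ℝ) < 1 / 2)]
  have h3 : |sgnF a * sgnF b * K z x b a| ≤ C * Real.exp (-δ * (l1 (x - p) + l1 (z - p))) := by
    rw [abs_mul, hs, one_mul]; exact h2
  have h4 := abs_add_le (K x z a b) (sgnF a * sgnF b * K z x b a)
  nlinarith [h4, h1, h3, abs_nonneg (K x z a b + sgnF a * sgnF b * K z x b a)]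

variable (L : ℕ) (tabs : SymTables 3 L)

/-- [folklore] **`biLoc_M2Z`** — under (Lmix) the symmetrised mixed table at the fine bond `(u, κ)` and coarse source `β` is bi-localised at `(u, u)` with the constant `wM2·C·e^{−δ|u − L•β.1|₁}`. -/
theorem biLoc_M2Z {C δ : ℝ} (hmix : LocStencilFM L tabs.mixFF C δ) (u : Site (3 + 1)) (κ : Fin (3 + 1)) (β : Site (3 + 1) × Fin (3 + 1)) :
    BiLoc (M2Z L tabs (u, κ) β) u u (|wM2 3 L 0| * (C * Real.exp (-δ * l1 (u - ((L : ℕ) : ℤ) • β.1)))) δ := by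
  rw [M2Z_eq]
  exact biLoc_evenHalf (biLoc_smul (wM2 3 L 0) (hmix κ u β.2 β.1))

/-- [folklore] the mixed table rescaled by `e^{+δ|u − L•β.1|₁}` is bi-localised at `(u,u)` with the UNIFORM constant `wM2·C`. -/
theorem biLoc_rescaled_M2Z {C δ : ℝ} (hmix : LocStencilFM L tabs.mixFF C δ) (u : Site (3 + 1)) (κ : Fin (3 + 1)) (β : Site (3 + 1) × Fin (3 + 1)) :
    BiLoc (Real.exp (δ * l1 (u - ((L : ℕ) : ℤ) • β.1)) • M2Z L tabs (u, κ) β) u u (|wM2 3 L 0| * C) δ := by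
  intro x z a b
  have h := biLoc_M2Z L tabs hmix u κ β x z a b
  rw [Pi.smul_apply, Pi.smul_apply, Pi.smul_apply, Pi.smul_apply, smul_eq_mul, abs_mul, abs_of_pos (Real.exp_pos _)]
  have hC : 0 ≤ C := hmix.nonneg
  calc Real.exp (δ * l1 (u - ((L : ℕ) : ℤ) • β.1)) * |M2Z L tabs (u, κ) β x z a b|
      ≤ Real.exp (δ * l1 (u - ((L : ℕ) : ℤ) • β.1)) * (|wM2 3 L 0| * (C * Real.exp (-δ * l1 (u - ((L : ℕ) : ℤ) • β.1))) * Real.exp (-δ * (l1 (x - u) + l1 (z - u)))) :=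
        mul_le_mul_of_nonneg_left h (Real.exp_pos _).le
    _ = |wM2 3 L 0| * C * Real.exp (-δ * (l1 (x - u) + l1 (z - u))) := by
        have e : Real.exp (δ * l1 (u - ((L : ℕ) : ℤ) • β.1)) * Real.exp (-δ * l1 (u - ((L : ℕ) : ℤ) • β.1)) = 1 := by
          rw [← Real.exp_add]; simp
        calc _ = (Real.exp (δ * l1 (u - ((L : ℕ) : ℤ) • β.1)) * Real.exp (-δ * l1 (u - ((L : ℕ) : ℤ) • β.1)))
              * (|wM2 3 L 0| * C * Real.exp (-δ * (l1 (x - u) + l1 (z - u)))) := by ring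
          _ = _ := by rw [e, one_mul]

/-! ## §2 The gradient term of `defKerZ` is a `wsum`, bi-localised at the window -/

/-- [folklore] **`gradTerm_eq_wsum`** — PART 62's direction-`κ` site series is a lit `wsum`: with `w′ u := (v(u+e_κ) − v u)·e^{−δ|u−L•β.1|₁}` and `K′ u := e^{δ|u−L•β.1|₁} • M2Z (u,κ) β`,
`Σ'_u (v(u+e_κ) − v u)·M2Z (u,κ) β x z a b = wsum w′ K′ x z a b` (pointwise `e^{−t}·e^{t} = 1`). -/
theorem gradTerm_eq_wsum (δ : ℝ) (v : Site (3 + 1) → ℝ) (κ : Fin (3 + 1)) (β : Site (3 + 1) × Fin (3 + 1)) (x z : Site (3 + 1)) (a b : Fib 3) :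
    (∑' u : Site (3 + 1), (v (u + unitVec κ) - v u) * M2Z L tabs (u, κ) β x z a b)
      = wsum (fun u => (v (u + unitVec κ) - v u) * Real.exp (-δ * l1 (u - ((L : ℕ) : ℤ) • β.1)))
          (fun u => Real.exp (δ * l1 (u - ((L : ℕ) : ℤ) • β.1)) • M2Z L tabs (u, κ) β) x z a b := by
  unfold wsum
  refine tsum_congr fun u => ?_
  simp only [Pi.smul_apply, smul_eq_mul]
  have e : Real.exp (-δ * l1 (u - ((L : ℕ) : ℤ) • β.1)) * Real.exp (δ * l1 (u - ((L : ℕ) : ℤ) • β.1)) = 1 := by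
    rw [← Real.exp_add]; simp
  calc (v (u + unitVec κ) - v u) * M2Z L tabs (u, κ) β x z a b
      = (v (u + unitVec κ) - v u) * (Real.exp (-δ * l1 (u - ((L : ℕ) : ℤ) • β.1)) * Real.exp (δ * l1 (u - ((L : ℕ) : ℤ) • β.1)))
          * M2Z L tabs (u, κ) β x z a b := by rw [e, mul_one]
    _ = _ := by ring

/-- [folklore] **`biLoc_gradTerm`** — for `|v| ≤ V` and (Lmix) at rate `δ > 0`, each direction's gradient series is bi-localised at the window:
`BiLoc (x z a b ↦ Σ'_u (v(u+e_κ) − v u)·M2Z (u,κ) β x z a b) (L•β.1) (L•β.1) (2V·(wM2·C)·Zl(δ/2)) (δ/2)` (lit `biLoc_wsum`). -/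
theorem biLoc_gradTerm {C δ : ℝ} (hmix : LocStencilFM L tabs.mixFF C δ) (hδ : 0 < δ) {v : Site (3 + 1) → ℝ} {V : ℝ} (hV : 0 ≤ V)
    (hv : ∀ u, |v u| ≤ V) (κ : Fin (3 + 1)) (β : Site (3 + 1) × Fin (3 + 1)) :
    BiLoc (fun x z a b => ∑' u : Site (3 + 1), (v (u + unitVec κ) - v u) * M2Z L tabs (u, κ) β x z a b)
      (((L : ℕ) : ℤ) • β.1) (((L : ℕ) : ℤ) • β.1) (2 * V * (|wM2 3 L 0| * C) * Zl (3 + 1) (δ / 2)) (δ / 2) := by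
  have hw : ∀ u : Site (3 + 1), |(v (u + unitVec κ) - v u) * Real.exp (-δ * l1 (u - ((L : ℕ) : ℤ) • β.1))|
      ≤ 2 * V * Real.exp (-δ * l1 (u - ((L : ℕ) : ℤ) • β.1)) := by
    intro u
    rw [abs_mul, abs_of_pos (Real.exp_pos _)]
    refine mul_le_mul_of_nonneg_right ?_ (Real.exp_pos _).le
    calc |v (u + unitVec κ) - v u| ≤ |v (u + unitVec κ)| + |v u| := abs_sub _ _
      _ ≤ V + V := add_le_add (hv _) (hv _)
      _ = 2 * V := by ring
  have h := biLoc_wsum hw (fun u => biLoc_rescaled_M2Z L tabs hmix u κ β) hδ (by positivity)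
  intro x z a b
  dsimp only
  rw [gradTerm_eq_wsum L tabs δ v κ β x z a b]
  exact h x z a b

/-! ## §3 The defect kernel is bi-localised at the window -/

/-- [folklore] **`biLoc_defKerZ` — THE WARD-DEFECT KERNEL OF A BOUNDED GAUGE FUNCTION IS BI-LOCALISED AT ITS COARSE WINDOW**: for `|v| ≤ V`, (Lmix) `LocStencilFM L tabs.mixFF C δ` (`δ > 0`) and
(LH) `VertexFamily tabs.H L C_H (δ/2)`: `BiLoc (defKerZ L tabs κ₂ v β) (L•β.1) (L•β.1) ((3+1)·(2V·(wM2·C)·Zl(δ/2)) + 2·|κ₂|·V·C_H) (δ/2)`. -/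
theorem biLoc_defKerZ {C δ C_H : ℝ} (hmix : LocStencilFM L tabs.mixFF C δ) (hδ : 0 < δ) (hH : VertexFamily tabs.H L C_H (δ / 2))
    (κ₂ : ℝ) {v : Site (3 + 1) → ℝ} {V : ℝ} (hV : 0 ≤ V) (hv : ∀ u, |v u| ≤ V) (β : Site (3 + 1) × Fin (3 + 1)) :
    BiLoc (defKerZ L tabs κ₂ v β) (((L : ℕ) : ℤ) • β.1) (((L : ℕ) : ℤ) • β.1)
      (((3 + 1 : ℕ) : ℝ) * (2 * V * (|wM2 3 L 0| * C) * Zl (3 + 1) (δ / 2)) + 2 * |κ₂| * V * C_H) (δ / 2) := by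
  have hC : 0 ≤ C := hmix.nonneg
  have hCH : 0 ≤ C_H := (hH β.2 β.1).nonneg (Sum.inl 0)
  have hZ : 0 ≤ Zl (3 + 1) (δ / 2) := Zl_nonneg (half_pos hδ)
  set G : ℝ := 2 * V * (|wM2 3 L 0| * C) * Zl (3 + 1) (δ / 2) with hG
  have hG0 : 0 ≤ G := by rw [hG]; positivity
  intro x z a b
  set E : ℝ := Real.exp (-(δ / 2) * (l1 (x - ((L : ℕ) : ℤ) • β.1) + l1 (z - ((L : ℕ) : ℤ) • β.1))) with hE
  have hE0 : 0 ≤ E := (Real.exp_pos _).le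
  have htot : 0 ≤ (((3 + 1 : ℕ) : ℝ) * G + 2 * |κ₂| * V * C_H) * E := by positivity
  rcases a with α | m
  · rcases b with α' | m'
    · rw [defKerZ_apply_inl_inl]
      -- gradient part: four directions, each `≤ G·E`
      have hgrad : |∑ κ : Fin (3 + 1), ∑' u : Site (3 + 1), (v (u + unitVec κ) - v u) * M2Z L tabs (u, κ) β x z (Sum.inl α) (Sum.inl α')|
          ≤ ((3 + 1 : ℕ) : ℝ) * G * E := by
        refine (Finset.abs_sum_le_sum_abs _ _).trans ?_
        have hk : ∀ κ : Fin (3 + 1), |∑' u : Site (3 + 1), (v (u + unitVec κ) - v u) * M2Z L tabs (u, κ) β x z (Sum.inl α) (Sum.inl α')| ≤ G * E :=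
          fun κ => biLoc_gradTerm L tabs hmix hδ hV hv κ β x z (Sum.inl α) (Sum.inl α')
        refine (Finset.sum_le_sum fun κ _ => hk κ).trans ?_
        rw [Finset.sum_const, nsmul_eq_mul, Finset.card_univ, Fintype.card_fin]
        exact le_of_eq (by push_cast; ring)
      -- commutator part: `≤ 2|κ₂| V C_H · E`
      have hcomm : |κ₂ * (v x * tabs.H β.2 β.1 x z (Sum.inl α) (Sum.inl α') - tabs.H β.2 β.1 x z (Sum.inl α) (Sum.inl α') * v z)|
          ≤ 2 * |κ₂| * V * C_H * E := by
        have hHe := hH β.2 β.1 x z (Sum.inl α) (Sum.inl α')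
        rw [abs_mul]
        have h1 : |v x * tabs.H β.2 β.1 x z (Sum.inl α) (Sum.inl α') - tabs.H β.2 β.1 x z (Sum.inl α) (Sum.inl α') * v z| ≤ 2 * V * (C_H * E) := by
          refine (abs_sub _ _).trans ?_
          rw [abs_mul, abs_mul]
          nlinarith [hv x, hv z, hHe, abs_nonneg (v x), abs_nonneg (v z), abs_nonneg (tabs.H β.2 β.1 x z (Sum.inl α) (Sum.inl α')), mul_nonneg hCH hE0]
        nlinarith [h1, abs_nonneg κ₂]
      calc |(∑ κ : Fin (3 + 1), ∑' u : Site (3 + 1), (v (u + unitVec κ) - v u) * M2Z L tabs (u, κ) β x z (Sum.inl α) (Sum.inl α'))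
              - κ₂ * (v x * tabs.H β.2 β.1 x z (Sum.inl α) (Sum.inl α') - tabs.H β.2 β.1 x z (Sum.inl α) (Sum.inl α') * v z)|
          ≤ ((3 + 1 : ℕ) : ℝ) * G * E + 2 * |κ₂| * V * C_H * E := (abs_sub _ _).trans (add_le_add hgrad hcomm)
        _ = (((3 + 1 : ℕ) : ℝ) * G + 2 * |κ₂| * V * C_H) * E := by ring
    · rw [defKerZ_inr_right, abs_zero]; exact htot
  · rw [defKerZ_inr_left, abs_zero]; exact htot

end Summit.QuantumFields.BalabanUV.Beta.FP.TowerDoorDefectLoc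

end
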